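import Mathlib
import HarnessLib
import Literature.MathematicalPhysics.KineticTheory.VelocityFlipNoise
import Summits.AtomisticToContinuum.FouriersLaw.Theorems.VanishingNoiseTransferVanishingNoiseBoundNoisyKuboLink
import Summits.AtomisticToContinuum.FouriersLaw.Theorems.OddSectorIrreversibilityResponseDensityGibbsCutoff
import Summits.AtomisticToContinuum.FouriersLaw.Theorems.VanishingNoiseTransferVanishingNoiseBoundFlipDualTranspose

/-!
# The exact DUAL response identity of the velocity-flip chain (dual Kubo road, part 2/3)

`--supports stmt-AtomisticToContinuum-11976` helper file (crux `VanishingNoiseBound`, route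
`VanishingNoiseTransfer`, line `fekete-usc-one-length`, stub S3' `stub_flipForwardFieldRegularity`, wave 4).

The landed reduction `noisyPositiveConductance_of_flipForwardFields` (…NoisyPositiveConductanceOfForwardField)
tests the weak stationarity of the flip steady state `μ_δ` (temperatures `T ± δ/2`) against the EQUILIBRIUM forward
field `g` of `L_{T,T} + εS`; since `L_δ − L_{T,T} = (γδ/2)(∂²_{p_0} − ∂²_{p_{L−1}})` this needs pointwise exponential
bounds on `∂_{p_b} g`, `∂²_{p_b} g` (hypothesis `FF(ε)`, the `ε > 0` twin of the OPEN contact-gradient bound `CG` of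
crux 11749). DUALITY removes them (the device of route `OddSectorIrreversibility/ResponseDensity`,
`…ResponseDensityResponseIdentity`: `Lᵀ_δ e^{-H/T} = δ(γ/2T²)(p_0² − p_{L−1}²) e^{-H/T}`): test the `δ`-DEPENDENT
forward field of `L_δ + εS` against the EXPLICIT Gibbs density, on which every derivative is computable.

* `flip_dualKubo_identity` — **the exact dual response identity.** If `u` is measurable, `|u| ≤ C e^{ϑH}`
  (`ϑ < 1/T`) and `(L_{T_L,T_R} + εS) u = −(p_0² − T) + c` in `𝓓'` (tested against `C_c^∞` through the Lebesgue
  transpose `−L + 2γ(T_L ∂²_{p_0} + T_R ∂²_{p_{L−1}}) + 2γ + εS` of part 1), then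
  `c = (γ/T²)((T_L − T)⟨u, p_0² − T⟩_{μ_T} + (T_R − T)⟨u, p_{L−1}² − T⟩_{μ_T})`. Proof: test on `χ(H/R) e^{-H/T}`
  (`…ResponseDensityGibbsCutoff`), `dualTest_comp_hamiltonian` (part 1, `…FlipDualTranspose`), dominated convergence
  `R → ∞`, equipartition `μ_T(p_0²) = T`. NO smoothness and NO derivative of `u` is involved.
* `helper_flipDualKuboIdentity` — registered helper (notation-free restatement).

References: Bonetto–Lebowitz–Rey-Bellet 2000 eq. (32); Rey-Bellet 2003 Rem. 4.4; Bernardin–Olla 2011 §2.1.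
-/

noncomputable section

open MeasureTheory Filter Topology Set ProbabilityTheory
open scoped ContDiff NNReal ENNReal
open Literature.MathematicalPhysics.KineticTheory.HeatConduction
open Literature.MathematicalPhysics.KineticTheory Literature.Probability.Process OscillatorChain
open Summit.AtomisticToContinuum.FouriersLaw.Theorems
open Summit.AtomisticToContinuum.FouriersLaw.Theorems.SubdiffusiveBondHeat (abs_sq_momentum_sub_le_exp integrable_of_abs_le_exp)
open Summit.AtomisticToContinuum.FouriersLaw.Cruxes.SuperadditiveResistance.FloatingProbeBypassLaplacian
  (pinnedChain_memLp_two_snd pinnedChain_integral_snd_sq)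
open Summit.AtomisticToContinuum.FouriersLaw.Theorems.SuperadditiveResistance.DeviceLiouville (kin kin_eq_sq)
open Summit.AtomisticToContinuum.FouriersLaw.Cruxes.ConductanceLowerBound.ForecastSensitivity (memLp_two_of_abs_le_exp)

namespace Summit.AtomisticToContinuum.FouriersLaw.Theorems.VanishingNoiseBound

section Dual

variable {ω₂ lam β γ : ℝ}

/-- **The exact dual response identity of the flip chain.** For the pinned chain (`ω₂ > 0`, `lam, β ≥ 0`, any
`γ, ε`), `L ≥ 2`, a reference temperature `T > 0`, bath temperatures `T_L, T_R` and a constant `c`: if `u` is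
measurable with `|u| ≤ C e^{ϑH}` (`ϑ < 1/T`) and
`∫ u · (−L_{T_L,T_R}φ + 2γ(T_L ∂²_{p_0}φ + T_R ∂²_{p_{L−1}}φ) + 2γφ + εSφ) dx = ∫ (−(p_0² − T) + c) φ dx` for every
`φ ∈ C_c^∞` (i.e. `(L_{T_L,T_R} + εS) u = −(p_0² − T) + c` in `𝓓'`), then
`c = (γ/T²)((T_L − T) ∫ u (p_0² − T) dμ_T + (T_R − T) ∫ u (p_{L−1}² − T) dμ_T)`. -/
theorem flip_dualKubo_identity (hω : 0 < ω₂) (hl : 0 ≤ lam) (hβ : 0 ≤ β) {L : ℕ} (hL2 : 2 ≤ L) {T : ℝ}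
    (hT : 0 < T) (T_L T_R ε c : ℝ) {u : PhaseSpace L → ℝ} (hum : AEStronglyMeasurable u volume) {C ϑ : ℝ}
    (hϑ : ϑ < 1 / T)
    (hub : ∀ x, |u x| ≤ C * Real.exp (ϑ * (pinnedChain ω₂ lam β γ).hamiltonian L x))
    (hweak : ∀ φ : PhaseSpace L → ℝ, ContDiff ℝ ((⊤ : ℕ∞) : WithTop ℕ∞) φ → HasCompactSupport φ →
      ∫ x, u x * (-((pinnedChain ω₂ lam β γ).generator L T_L T_R φ x) +
          2 * γ * (T_L * partialP (⟨0, by omega⟩ : Fin L) (partialP (⟨0, by omega⟩ : Fin L) φ) x +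
            T_R * partialP (⟨L - 1, by omega⟩ : Fin L) (partialP (⟨L - 1, by omega⟩ : Fin L) φ) x) +
          2 * γ * φ x + ε * flipNoise L φ x) =
        ∫ x, (-(kin L 0 x - T) + c) * φ x) :
    c = γ / T ^ 2 * ((T_L - T) * ∫ x, u x * (kin L 0 x - T) ∂((pinnedChain ω₂ lam β γ).gibbsMeasure L T) +
      (T_R - T) * ∫ x, u x * (kin L (L - 1) x - T) ∂((pinnedChain ω₂ lam β γ).gibbsMeasure L T)) := by
  have hL : 0 < L := by omega
  have hL1 : L - 1 < L := by omega
  set P := pinnedChain ω₂ lam β γ with hP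
  set H : PhaseSpace L → ℝ := P.hamiltonian L with hH
  set μT := P.gibbsMeasure L T with hμT
  set i0 : Fin L := ⟨0, hL⟩ with hi0
  set i1 : Fin L := ⟨L - 1, hL1⟩ with hi1
  set θ : ℝ := -1 / T with hθ
  have hHc : Continuous H := pinnedChain_continuous_hamiltonian ω₂ lam β γ L
  have hHs : ContDiff ℝ ((⊤ : ℕ∞) : WithTop ℕ∞) H := pinnedChain_contDiff_hamiltonian ω₂ lam β γ L
  have hH0 : ∀ x, 0 ≤ H x := fun x => pinnedChain_hamiltonian_nonneg hω.le hl hβ γ L x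
  have hC : 0 ≤ C := by
    have h := hub 0
    exact nonneg_of_mul_nonneg_left ((abs_nonneg _).trans h) (Real.exp_pos _)
  have hkin0 : ∀ x : PhaseSpace L, kin L 0 x = x.2 i0 ^ 2 := fun x => kin_eq_sq hL x
  have hkin1 : ∀ x : PhaseSpace L, kin L (L - 1) x = x.2 i1 ^ 2 := fun x => kin_eq_sq hL1 x
  -- the Gibbs density and the partition function
  set ρ : PhaseSpace L → ℝ := fun x => Real.exp (θ * H x) with hρ
  have hρρ : ∀ x, ρ x = P.gibbsDensity L T x := fun x => by
    simp only [hρ, OscillatorChain.gibbsDensity, hθ]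
    congr 1; ring
  have hρc : Continuous ρ := by rw [hρ]; fun_prop
  have hρi : Integrable (P.gibbsDensity L T) := pinnedChain_integrable_gibbsDensity hω hl hβ γ L hT
  set Z : ℝ := ∫ x, P.gibbsDensity L T x with hZ
  have hZ0 : 0 < Z := integral_exp_pos hρi
  have hgibbs : ∀ f : PhaseSpace L → ℝ, ∫ x, f x * ρ x = Z * ∫ x, f x ∂μT := by
    intro f
    rw [hμT, P.integral_gibbsMeasure, ← hZ, ← mul_assoc, mul_inv_cancel₀ hZ0.ne', one_mul]
    exact integral_congr_ae (ae_of_all _ fun x => by simp only [hρρ x])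
  -- bounds on the cutoff derivatives
  obtain ⟨S₁, hS₁0, hS₁⟩ := Theorems.exists_bound_deriv_smoothCutoff
  obtain ⟨S₂, hS₂0, hS₂⟩ := Theorems.exists_bound_deriv_deriv_smoothCutoff
  -- the truncated Gibbs weights `F_R(v) = χ(v/R) e^{θv}` and their derivatives
  set F : ℝ → ℝ → ℝ := fun R v => smoothCutoff (v / R) * Real.exp (θ * v) with hF
  set F' : ℝ → ℝ → ℝ := fun R v => deriv smoothCutoff (v / R) / R * Real.exp (θ * v) +
    smoothCutoff (v / R) * (θ * Real.exp (θ * v)) with hF'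
  set F'' : ℝ → ℝ → ℝ := fun R v => deriv (deriv smoothCutoff) (v / R) / R ^ 2 * Real.exp (θ * v) +
    2 * (deriv smoothCutoff (v / R) / R) * (θ * Real.exp (θ * v)) +
    smoothCutoff (v / R) * (θ ^ 2 * Real.exp (θ * v)) with hF''
  have hdF : ∀ R v, HasDerivAt (F R) (F' R v) v := fun R v => hasDerivAt_cutoffExp θ R v
  have hdF' : ∀ R v, HasDerivAt (F' R) (F'' R v) v := fun R v => hasDerivAt_deriv_cutoffExp θ R v
  set A : ℝ := 1 + (S₁ + |θ|) + (S₂ + 2 * S₁ * |θ| + θ ^ 2) with hA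
  have hA1 : 1 ≤ A := by
    have h1 : 0 ≤ S₁ + |θ| := by positivity
    have h2 : 0 ≤ S₂ + 2 * S₁ * |θ| + θ ^ 2 := by positivity
    rw [hA]; linarith
  have hA0 : 0 ≤ A := by linarith
  have hFb : ∀ {R : ℝ}, 1 ≤ R → ∀ v, |F R v| ≤ A * Real.exp (θ * v) := fun hR v =>
    (abs_cutoffExp_le θ _ v).trans (le_mul_of_one_le_left (Real.exp_pos _).le hA1)
  have hF'b : ∀ {R : ℝ}, 1 ≤ R → ∀ v, |F' R v| ≤ A * Real.exp (θ * v) := fun hR v =>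
    (abs_deriv_cutoffExp_le θ hS₁ hR v).trans
      (mul_le_mul_of_nonneg_right (by rw [hA]; nlinarith [abs_nonneg θ]) (Real.exp_pos _).le)
  have hF''b : ∀ {R : ℝ}, 1 ≤ R → ∀ v, |F'' R v| ≤ A * Real.exp (θ * v) := fun hR v =>
    (abs_deriv_deriv_cutoffExp_le θ hS₁ hS₂ hR v).trans
      (mul_le_mul_of_nonneg_right (by rw [hA]; nlinarith [abs_nonneg θ]) (Real.exp_pos _).le)
  -- the test functions `φ_R = F_R ∘ H`
  have hφs : ∀ R : ℝ, ContDiff ℝ ((⊤ : ℕ∞) : WithTop ℕ∞) (fun x => F R (H x)) := fun R =>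
    (contDiff_cutoffExp θ R).comp hHs
  have hφc : ∀ {R : ℝ}, 0 < R → HasCompactSupport (fun x => F R (H x)) := by
    intro R hR
    refine HasCompactSupport.intro (pinnedChain_isCompact_setOf_hamiltonian_le hω hl hβ γ L (2 * R)) ?_
    intro x hx
    have hx' : 2 * R ≤ H x := le_of_lt (not_le.mp hx)
    exact cutoffExp_of_ge θ hR hx'
  -- the transposed operator on `φ_R`, pointwise
  set Ψ : ℝ → PhaseSpace L → ℝ := fun R x =>
    γ * ((T_L * (F'' R (H x) * x.2 i0 ^ 2 + F' R (H x)) + F' R (H x) * x.2 i0 ^ 2 + F R (H x)) +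
      (T_R * (F'' R (H x) * x.2 i1 ^ 2 + F' R (H x)) + F' R (H x) * x.2 i1 ^ 2 + F R (H x))) with hΨ
  have hEq : ∀ R : ℝ, 0 < R → ∫ x, u x * Ψ R x = ∫ x, (-(kin L 0 x - T) + c) * F R (H x) := by
    intro R hR
    rw [← hweak _ (hφs R) (hφc hR)]
    refine integral_congr_ae (ae_of_all _ fun x => ?_)
    dsimp only
    rw [dualTest_comp_hamiltonian hL2 T_L T_R ε (hdF R) (hdF' R) x]
  -- the exponent bookkeeping
  set η : ℝ := (1 / T - ϑ) / 2 with hη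
  have hη0 : 0 < η := by rw [hη]; linarith
  have hexp1 : ∀ x, Real.exp (ϑ * H x) * Real.exp (θ * H x) * Real.exp (η * H x) = Real.exp (-(η * H x)) := by
    intro x
    rw [← Real.exp_add, ← Real.exp_add]
    congr 1
    rw [hη, hθ]; field_simp; ring
  have hexp2 : ∀ x, Real.exp (1 / (2 * T) * H x) * Real.exp (θ * H x) = Real.exp (-(1 / (2 * T) * H x)) := by
    intro x
    rw [← Real.exp_add]
    congr 1
    rw [hθ]; field_simp; ring
  have h2T : 0 < 1 / (2 * T) := by positivity
  -- (1) the left-hand sides converge: dominated convergence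
  set Ψinf : PhaseSpace L → ℝ := fun x =>
    γ * ((T_L * (θ ^ 2 * ρ x * x.2 i0 ^ 2 + θ * ρ x) + θ * ρ x * x.2 i0 ^ 2 + ρ x) +
      (T_R * (θ ^ 2 * ρ x * x.2 i1 ^ 2 + θ * ρ x) + θ * ρ x * x.2 i1 ^ 2 + ρ x)) with hΨinf
  set Kc : ℝ := C * (|γ| * (A * ((|T_L| + 1) * (2 / η + 1) + (|T_R| + 1) * (2 / η + 1)))) with hKc
  have hΨb : ∀ n : ℕ, ∀ x, |u x * Ψ ((n : ℝ) + 1) x| ≤ Kc * Real.exp (-(η * H x)) := by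
    intro n x
    have hR1 : (1 : ℝ) ≤ (n : ℝ) + 1 := by simp
    set e := Real.exp (θ * H x) with he
    have he0 : 0 ≤ e := (Real.exp_pos _).le
    have hb0 := abs_bathBracket_le (t := T_L) (p := x.2 i0) (hFb hR1 (H x)) (hF'b hR1 (H x)) (hF''b hR1 (H x))
    have hb1 := abs_bathBracket_le (t := T_R) (p := x.2 i1) (hFb hR1 (H x)) (hF'b hR1 (H x)) (hF''b hR1 (H x))
    have hp0 := sq_momentum_add_one_le hω hl hβ γ hη0 x i0
    have hp1 := sq_momentum_add_one_le hω hl hβ γ hη0 x i1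
    set w := Real.exp (η * H x) with hw
    have hw0 : 0 ≤ w := (Real.exp_pos _).le
    have hsum : |Ψ ((n : ℝ) + 1) x| ≤
        |γ| * (A * ((|T_L| + 1) * (2 / η + 1) + (|T_R| + 1) * (2 / η + 1))) * (e * w) := by
      rw [hΨ]
      dsimp only
      rw [abs_mul]
      refine (mul_le_mul_of_nonneg_left (abs_add_le _ _) (abs_nonneg _)).trans ?_
      have e1 : A * e * (|T_L| + 1) * (x.2 i0 ^ 2 + 1) ≤ A * e * (|T_L| + 1) * ((2 / η + 1) * w) :=
        mul_le_mul_of_nonneg_left hp0 (by positivity)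
      have e2 : A * e * (|T_R| + 1) * (x.2 i1 ^ 2 + 1) ≤ A * e * (|T_R| + 1) * ((2 / η + 1) * w) :=
        mul_le_mul_of_nonneg_left hp1 (by positivity)
      have := add_le_add (hb0.trans e1) (hb1.trans e2)
      calc |γ| * (|T_L * (F'' ((n : ℝ) + 1) (H x) * x.2 i0 ^ 2 + F' ((n : ℝ) + 1) (H x)) +
              F' ((n : ℝ) + 1) (H x) * x.2 i0 ^ 2 + F ((n : ℝ) + 1) (H x)| +
            |T_R * (F'' ((n : ℝ) + 1) (H x) * x.2 i1 ^ 2 + F' ((n : ℝ) + 1) (H x)) +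
              F' ((n : ℝ) + 1) (H x) * x.2 i1 ^ 2 + F ((n : ℝ) + 1) (H x)|)
          ≤ |γ| * (A * e * (|T_L| + 1) * ((2 / η + 1) * w) + A * e * (|T_R| + 1) * ((2 / η + 1) * w)) :=
            mul_le_mul_of_nonneg_left this (abs_nonneg _)
        _ = |γ| * (A * ((|T_L| + 1) * (2 / η + 1) + (|T_R| + 1) * (2 / η + 1))) * (e * w) := by ring
    calc |u x * Ψ ((n : ℝ) + 1) x| = |u x| * |Ψ ((n : ℝ) + 1) x| := abs_mul _ _
      _ ≤ (C * Real.exp (ϑ * H x)) *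
          (|γ| * (A * ((|T_L| + 1) * (2 / η + 1) + (|T_R| + 1) * (2 / η + 1))) * (e * w)) :=
          mul_le_mul (hub x) hsum (abs_nonneg _) (by positivity)
      _ = Kc * (Real.exp (ϑ * H x) * e * w) := by rw [hKc]; ring
      _ = Kc * Real.exp (-(η * H x)) := by rw [he, hw, hexp1 x]
  have hΨlim : ∀ x, Tendsto (fun n : ℕ => u x * Ψ ((n : ℝ) + 1) x) atTop (𝓝 (u x * Ψinf x)) := by
    intro x
    obtain ⟨N₀, hN₀⟩ := exists_nat_gt (H x)
    refine tendsto_const_nhds.congr' ?_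
    filter_upwards [eventually_ge_atTop N₀] with n hn
    have hRpos : (0 : ℝ) < (n : ℝ) + 1 := by positivity
    have hlt : H x < (n : ℝ) + 1 := by
      have : (N₀ : ℝ) ≤ n := by exact_mod_cast hn
      linarith
    have e0 : F ((n : ℝ) + 1) (H x) = ρ x := cutoffExp_of_lt θ hRpos hlt
    have e1 : F' ((n : ℝ) + 1) (H x) = θ * ρ x := deriv_cutoffExp_of_lt θ hRpos hlt
    have e2 : F'' ((n : ℝ) + 1) (H x) = θ ^ 2 * ρ x := deriv_deriv_cutoffExp_of_lt θ hRpos hlt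
    rw [hΨ, hΨinf]
    dsimp only
    rw [e0, e1, e2]
  have hΨm : ∀ n : ℕ, AEStronglyMeasurable (fun x => u x * Ψ ((n : ℝ) + 1) x) volume := by
    intro n
    refine hum.mul (Continuous.aestronglyMeasurable ?_)
    have h1 : Continuous (F ((n : ℝ) + 1)) := (contDiff_cutoffExp θ _).continuous
    have hsc : Continuous smoothCutoff := (contDiff_smoothCutoff (n := 0)).continuous
    have hsc1 : Continuous (deriv smoothCutoff) := Theorems.continuous_deriv_smoothCutoff
    have hsc2 : Continuous (deriv (deriv smoothCutoff)) := Theorems.continuous_deriv_deriv_smoothCutoff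
    have h2 : Continuous (F' ((n : ℝ) + 1)) := by
      rw [hF']
      fun_prop
    have h3 : Continuous (F'' ((n : ℝ) + 1)) := by
      rw [hF'']
      fun_prop
    rw [hΨ]
    fun_prop
  have hLHS : Tendsto (fun n : ℕ => ∫ x, u x * Ψ ((n : ℝ) + 1) x) atTop (𝓝 (∫ x, u x * Ψinf x)) := by
    refine tendsto_integral_of_dominated_convergence (fun x => Kc * Real.exp (-(η * H x))) hΨm
      ((pinnedChain_integrable_exp_neg_mul_hamiltonian hω hl hβ γ L hη0).const_mul Kc)
      (fun n => Eventually.of_forall fun x => ?_) (Eventually.of_forall hΨlim)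
    rw [Real.norm_eq_abs]; exact hΨb n x
  -- (2) the right-hand sides converge
  set kc : PhaseSpace L → ℝ := fun x => -(kin L 0 x - T) + c with hkc
  have hkcc : Continuous kc := by
    have : kc = fun x => -(x.2 i0 ^ 2 - T) + c := by funext x; simp only [hkc, hkin0 x]
    rw [this]; fun_prop
  have hkcb : ∀ x, |kc x| ≤ (2 / (1 / (2 * T)) + T + |c|) * Real.exp (1 / (2 * T) * H x) := by
    intro x
    have h1 := abs_sq_momentum_sub_le_exp (γ := γ) hω hl hβ h2T hT.le x i0
    have h2 : 1 ≤ Real.exp (1 / (2 * T) * H x) := Real.one_le_exp (mul_nonneg h2T.le (hH0 x))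
    have ekc : kc x = -(x.2 i0 ^ 2 - T) + c := by simp only [hkc, hkin0 x]
    rw [ekc]
    calc |-(x.2 i0 ^ 2 - T) + c| ≤ |-(x.2 i0 ^ 2 - T)| + |c| := abs_add_le _ _
      _ = |x.2 i0 ^ 2 - T| + |c| := by rw [abs_neg]
      _ ≤ (2 / (1 / (2 * T)) + T) * Real.exp (1 / (2 * T) * H x) + |c| * Real.exp (1 / (2 * T) * H x) :=
          add_le_add h1 (le_mul_of_one_le_right (abs_nonneg _) h2)
      _ = _ := by ring
  have hRHSb : ∀ n : ℕ, ∀ x, |kc x * F ((n : ℝ) + 1) (H x)| ≤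
      (2 / (1 / (2 * T)) + T + |c|) * Real.exp (-(1 / (2 * T) * H x)) := by
    intro n x
    rw [abs_mul]
    calc |kc x| * |F ((n : ℝ) + 1) (H x)|
        ≤ (2 / (1 / (2 * T)) + T + |c|) * Real.exp (1 / (2 * T) * H x) * Real.exp (θ * H x) :=
          mul_le_mul (hkcb x) (abs_cutoffExp_le θ _ _) (abs_nonneg _) (by positivity)
      _ = _ := by rw [mul_assoc, hexp2 x]
  have hRHSlim : ∀ x, Tendsto (fun n : ℕ => kc x * F ((n : ℝ) + 1) (H x)) atTop (𝓝 (kc x * ρ x)) := by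
    intro x
    obtain ⟨N₀, hN₀⟩ := exists_nat_gt (H x)
    refine tendsto_const_nhds.congr' ?_
    filter_upwards [eventually_ge_atTop N₀] with n hn
    have hRpos : (0 : ℝ) < (n : ℝ) + 1 := by positivity
    have hlt : H x < (n : ℝ) + 1 := by
      have : (N₀ : ℝ) ≤ n := by exact_mod_cast hn
      linarith
    have e0 : F ((n : ℝ) + 1) (H x) = ρ x := cutoffExp_of_lt θ hRpos hlt
    rw [e0]
  have hRHS : Tendsto (fun n : ℕ => ∫ x, kc x * F ((n : ℝ) + 1) (H x)) atTop (𝓝 (∫ x, kc x * ρ x)) := by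
    refine tendsto_integral_of_dominated_convergence
      (fun x => (2 / (1 / (2 * T)) + T + |c|) * Real.exp (-(1 / (2 * T) * H x)))
      (fun n => (hkcc.mul ((contDiff_cutoffExp θ _).continuous.comp hHc)).aestronglyMeasurable)
      ((pinnedChain_integrable_exp_neg_mul_hamiltonian hω hl hβ γ L h2T).const_mul _)
      (fun n => Eventually.of_forall fun x => ?_) (Eventually.of_forall hRHSlim)
    rw [Real.norm_eq_abs]; exact hRHSb n x
  -- (3) the two limits agree
  have hlim_eq : ∫ x, u x * Ψinf x = ∫ x, kc x * ρ x := by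
    have h : (fun n : ℕ => ∫ x, u x * Ψ ((n : ℝ) + 1) x) = fun n : ℕ => ∫ x, kc x * F ((n : ℝ) + 1) (H x) := by
      funext n; exact hEq _ (by positivity)
    rw [h] at hLHS
    exact tendsto_nhds_unique hLHS hRHS
  -- (4) evaluate the right-hand side: equipartition
  haveI : IsProbabilityMeasure μT := pinnedChain_isProbabilityMeasure_gibbsMeasure hω hl hβ γ L hT
  have hp2 : ∫ x, x.2 i0 ^ 2 ∂μT = T := pinnedChain_integral_snd_sq hω hl hβ γ L hT i0
  have hp2i : Integrable (fun x : PhaseSpace L => x.2 i0 ^ 2) μT :=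
    (pinnedChain_memLp_two_snd hω hl hβ γ L hT i0).integrable_sq
  have hRval : ∫ x, kc x * ρ x = c * Z := by
    rw [hgibbs kc]
    have e : (fun x => kc x) = fun x => (T + c) - x.2 i0 ^ 2 := by
      funext x; simp only [hkc, hkin0 x]; ring
    rw [show (∫ x, kc x ∂μT) = ∫ x, ((T + c) - x.2 i0 ^ 2) ∂μT from by rw [e],
      integral_sub (integrable_const _) hp2i, integral_const, probReal_univ, hp2]
    simp only [smul_eq_mul, one_mul]
    ring
  -- (5) evaluate the left-hand side
  have hΨinfeq : ∀ x, u x * Ψinf x =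
      γ / T ^ 2 * (T_L - T) * (u x * (x.2 i0 ^ 2 - T) * ρ x) +
        γ / T ^ 2 * (T_R - T) * (u x * (x.2 i1 ^ 2 - T) * ρ x) := by
    intro x
    rw [hΨinf]; dsimp only; rw [hθ]
    field_simp
    ring
  have hubi : ∀ i : Fin L, Integrable (fun x => u x * (x.2 i ^ 2 - T) * ρ x) volume := by
    intro i
    refine integrable_of_abs_le_exp_neg hω hl hβ γ ((hum.mul (by fun_prop)).mul hρc.aestronglyMeasurable) hη0
      (K := C * (2 / η + T)) fun x => ?_
    rw [abs_mul, abs_mul, abs_of_pos (Real.exp_pos _)]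
    calc |u x| * |x.2 i ^ 2 - T| * ρ x
        ≤ C * Real.exp (ϑ * H x) * ((2 / η + T) * Real.exp (η * H x)) * ρ x :=
          mul_le_mul_of_nonneg_right (mul_le_mul (hub x) (abs_sq_momentum_sub_le_exp (γ := γ) hω hl hβ hη0 hT.le x i)
            (abs_nonneg _) (by positivity)) (Real.exp_pos _).le
      _ = C * (2 / η + T) * (Real.exp (ϑ * H x) * Real.exp (θ * H x) * Real.exp (η * H x)) := by
          rw [hρ]; ring
      _ = C * (2 / η + T) * Real.exp (-(η * H x)) := by rw [hexp1 x]
  have hLval : ∫ x, u x * Ψinf x =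
      γ / T ^ 2 * (T_L - T) * (Z * ∫ x, u x * (kin L 0 x - T) ∂μT) +
        γ / T ^ 2 * (T_R - T) * (Z * ∫ x, u x * (kin L (L - 1) x - T) ∂μT) := by
    rw [integral_congr_ae (ae_of_all _ hΨinfeq), integral_add ((hubi i0).const_mul _) ((hubi i1).const_mul _),
      integral_const_mul, integral_const_mul, hgibbs (fun x => u x * (x.2 i0 ^ 2 - T)),
      hgibbs (fun x => u x * (x.2 i1 ^ 2 - T))]
    simp only [hkin0, hkin1]
  -- (6) conclude
  rw [hLval, hRval] at hlim_eq
  have hZne : Z ≠ 0 := hZ0.ne'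
  have : c = γ / T ^ 2 * (T_L - T) * (∫ x, u x * (kin L 0 x - T) ∂μT) +
      γ / T ^ 2 * (T_R - T) * (∫ x, u x * (kin L (L - 1) x - T) ∂μT) := by
    apply mul_right_cancel₀ hZne
    rw [← hlim_eq]; ring
  rw [this]; ring

end Dual

/-! ## Registered helper -/

/-- Registered helper sub-goal `helper_flipDualKuboIdentity` of stub `stub_flipForwardFieldRegularity` (line
`fekete-usc-one-length`, crux stmt-AtomisticToContinuum-11976): the exact dual response identity of the flip chain
(`flip_dualKubo_identity`). -/
theorem helper_flipDualKuboIdentity : ∀ (ω₂ lam β γ : ℝ), 0 < ω₂ → 0 ≤ lam → 0 ≤ β → ∀ (L : ℕ) (hL2 : 2 ≤ L) (T : ℝ), 0 < T → ∀ (T_L T_R ε c : ℝ) (u : Literature.MathematicalPhysics.KineticTheory.HeatConduction.PhaseSpace L → ℝ), MeasureTheory.AEStronglyMeasurable u MeasureTheory.volume → ∀ (C ϑ : ℝ), ϑ < 1 / T → (∀ x, |u x| ≤ C * Real.exp (ϑ * (Literature.MathematicalPhysics.KineticTheory.HeatConduction.pinnedChain ω₂ lam β γ).hamiltonian L x)) →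 (∀ φ : Literature.MathematicalPhysics.KineticTheory.HeatConduction.PhaseSpace L → ℝ, ContDiff ℝ ((⊤ : ℕ∞) : WithTop ℕ∞) φ → HasCompactSupport φ → MeasureTheory.integral MeasureTheory.volume (fun x => u x * (-((Literature.MathematicalPhysics.KineticTheory.HeatConduction.pinnedChain ω₂ lam β γ).generator L T_L T_R φ x) + 2 * γ * (T_L * Literature.MathematicalPhysics.KineticTheory.HeatConduction.partialP (⟨0, by omega⟩ : Fin L) (Literature.MathematicalPhysics.KineticTheory.HeatConduction.partialP (⟨0, by omega⟩ : Fin L) φ) x + T_R * Literature.MathematicalPhysics.KineticTheory.HeatConduction.partialP (⟨L - 1, by omega⟩ : Fin L) (Literature.MathematicalPhysics.KineticTheory.HeatConduction.partialP (⟨L - 1, by omega⟩ : Fin L) φ) x) + 2 * γ * φ x + ε * Literature.MathematicalPhysics.KineticTheory.HeatConduction.flipNoise L φ x)) = MeasureTheory.integral MeasureTheory.volume (fun x => (-(Summit.AtomisticToContinuum.FouriersLaw.Theorems.SuperadditiveResistance.DeviceLiouville.kin L 0 x - T) + c) * φ x)) → c = γ / T ^ 2 * ((T_L - T) * MeasureTheory.integral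 ((Literature.MathematicalPhysics.KineticTheory.HeatConduction.pinnedChain ω₂ lam β γ).gibbsMeasure L T) (fun x => u x * (Summit.AtomisticToContinuum.FouriersLaw.Theorems.SuperadditiveResistance.DeviceLiouville.kin L 0 x - T)) + (T_R - T) * MeasureTheory.integral ((Literature.MathematicalPhysics.KineticTheory.HeatConduction.pinnedChain ω₂ lam β γ).gibbsMeasure L T) (fun x => u x * (Summit.AtomisticToContinuum.FouriersLaw.Theorems.SuperadditiveResistance.DeviceLiouville.kin L (L - 1) x - T))) :=
  fun _ _ _ _ hω hl hβ _ hL2 _ hT T_L T_R ε c _ hum _ _ hϑ hub hweak =>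
    flip_dualKubo_identity hω hl hβ hL2 hT T_L T_R ε c hum hϑ hub hweak

end Summit.AtomisticToContinuum.FouriersLaw.Theorems.VanishingNoiseBound

end
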